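import Summits.CriticalPhenomena.PercolationContinuityZ3.Theorems.PercNearOneGluingNoHeavyLowerTailSunflowerTBernIrreducible
import Summits.CriticalPhenomena.PercolationContinuityZ3.Theorems.PercNearOneGluingNoHeavyLowerTailSunflowerTBernMergeT
import Summits.CriticalPhenomena.PercolationContinuityZ3.Theorems.PercNearOneGluingNoHeavyLowerTailSunflowerTBernMoves
import HarnessLib

/-!
# `NoHeavyLowerTail` (crux stmt-CriticalPhenomena-4575), abstract sunflower cubic: **T-BERN HOLDS** — hence the capped
# pendant lemma and (RES0′) for every number of petals

Support file (seat `prim-ineq-prove-1` gen 65; `--supports stmt-CriticalPhenomena-4575`).  No `sorry`, no named facts, no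
conjecture-shaped hypotheses.  Memo: run/shared/lean/prim/prim-ineq-prove-1/FINDING-REDUCTION-prove1-g65.md.

**`tbern_holds : TBern s b β V`** for all `0 < b ≤ β ≤ 1`, `0 ≤ s ≤ 1` (and every `V`), i.e. the coefficientwise (in `t`) capped
pendant lemma of `…SunflowerTBern` — until now a conjecture-shaped hypothesis (gen 62–64).  Consequently
**`cappedPendant_holds : CappedPendant s t b β V`** for `t ∈ [0,1]` (`cappedPendant_of_tbern`) and **`res0_all`**: the sharp
(RES0′) product inequality of `…SunflowerCappedPendant` (`res0_of_cappedPendant`) for EVERY number of petals and every admissible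
family of the abstract sunflower cubic, with no hypothesis left.

THE PROOF (`domOn_all`) is a double induction — on the number of petals, and, for a fixed index set, on the measure
`Σ_l petalWt l` (`2` per slack petal, `1` per tight rich petal) — running the reduction of the memo:
* two slack petals ⇒ u-exchange to an endpoint (`coeff_uExchange_le_max`, `admissibleOn_uExchange`; measure drops);
* two tight rich petals ⇒ joint scaling to an endpoint (`coeff_scale_le_max`, `admissibleOn_scale`; measure drops);
* two h-petals ⇒ merge (`domOn_of_merge_h`; one petal fewer);  h-petal + leveraged T2 ⇒ merge (`domOn_of_merge_hT`);
* otherwise the family is irreducible and `domOn_irreducible` (built on `domOn_of_gammaHeavy`, `domOn_of_noLeverage`,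
  `domOn_hub_pack_lev`, `domOn_hub_packT_h`, all resting on `hc_pack`) certifies it.
The case `s = 0` is `domOn_of_noLeverage` directly.
-/

noncomputable section

namespace Summit.CriticalPhenomena.PercolationContinuityZ3.Theorems.SunflowerPartition

namespace SafeCalc

namespace LinkedCurrency

open Finset Polynomial

variable {ι : Type*}

/-! ## The measure -/

/-- Weight of a petal in the reduction: `2` if slack (`m < u`), `1` if tight and rich (`m = u`, `m > b`, `vv > β`), else `0`.
[definition, this work] -/
def petalWt (b β : ℝ) (u vv m : ι → ℝ) (l : ι) : ℕ :=
  (if m l < u l then 2 else 0) + (if m l = u l ∧ b < m l ∧ β < vv l then 1 else 0)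

/-- A slack petal weighs `2`. [this work] -/
theorem petalWt_of_slack {b β : ℝ} {u vv m : ι → ℝ} {l : ι} (h : m l < u l) : petalWt b β u vv m l = 2 := by
  unfold petalWt
  rw [if_pos h, if_neg (fun h' => absurd h'.1 (ne_of_lt h))]

/-- A tight petal weighs at most `1`. [this work] -/
theorem petalWt_le_one_of_tight {b β : ℝ} {u vv m : ι → ℝ} {l : ι} (h : m l = u l) : petalWt b β u vv m l ≤ 1 := by
  unfold petalWt
  rw [if_neg (fun h' => absurd h (ne_of_lt h'))]
  split_ifs <;> norm_num

/-- A tight rich petal weighs `1`. [this work] -/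
theorem petalWt_of_rich {b β : ℝ} {u vv m : ι → ℝ} {l : ι} (h : m l = u l) (hb : b < m l) (hβ : β < vv l) :
    petalWt b β u vv m l = 1 := by
  unfold petalWt
  rw [if_neg (fun h' => absurd h (ne_of_lt h')), if_pos ⟨h, hb, hβ⟩]

/-- A tight non-rich petal weighs `0`. [this work] -/
theorem petalWt_of_tight_nonrich {b β : ℝ} {u vv m : ι → ℝ} {l : ι} (h : m l = u l) (hn : ¬ (b < m l ∧ β < vv l)) :
    petalWt b β u vv m l = 0 := by
  unfold petalWt
  rw [if_neg (fun h' => absurd h (ne_of_lt h')), if_neg (fun h' => hn h'.2)]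

/-- The weight depends only on the petal's own data. [this work] -/
theorem petalWt_congr {b β : ℝ} {u vv m u' vv' m' : ι → ℝ} {l : ι} (hu : u' l = u l) (hv : vv' l = vv l)
    (hm : m' l = m l) : petalWt b β u' vv' m' l = petalWt b β u vv m l := by
  unfold petalWt; rw [hu, hv, hm]

/-- If two functions agree off `{i, j}` and lose at least one unit on `{i, j}`, the sum over `t ∋ i, j` drops. [this work] -/
theorem sum_lt_of_pair [DecidableEq ι] {t : Finset ι} {i j : ι} (hij : i ≠ j) (hi : i ∈ t) (hj : j ∈ t) {w w' : ι → ℕ}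
    (ho : ∀ l ∈ t, l ≠ i → l ≠ j → w' l = w l) (hdrop : w' i + w' j + 1 ≤ w i + w j) :
    ∑ l ∈ t, w' l < ∑ l ∈ t, w l := by
  have hjt : j ∈ t.erase i := mem_erase.2 ⟨hij.symm, hj⟩
  rw [← add_sum_erase t w hi, ← add_sum_erase (t.erase i) w hjt, ← add_sum_erase t w' hi,
    ← add_sum_erase (t.erase i) w' hjt]
  have hrest : ∑ l ∈ (t.erase i).erase j, w' l = ∑ l ∈ (t.erase i).erase j, w l :=
    sum_congr rfl fun l hl => ho l (mem_of_mem_erase (mem_of_mem_erase hl)) (mem_erase.1 (mem_of_mem_erase hl)).1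
      (mem_erase.1 hl).1
  rw [hrest]
  omega

/-! ## The main induction -/

/-- **`DomOn` for EVERY nonempty admissible family** (`0 < b ≤ β ≤ 1`, `0 < s ≤ 1`). [this work] -/
theorem domOn_all [DecidableEq ι] {s b β V : ℝ} (hb : 0 < b) (hbβ : b ≤ β) (hβ1 : β ≤ 1) (hs0 : 0 < s) (hs1 : s ≤ 1) :
    ∀ (n : ℕ) (t : Finset ι) (u vv m : ι → ℝ), t.card = n → t.Nonempty → AdmissibleOn s b β V t u vv m →
      DomOn s b β V t u vv m := by
  have hs' : 0 ≤ 1 - s := sub_nonneg.2 hs1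
  have hβ : 0 < β := hb.trans_le hbβ
  have ha₀ : 0 < (1 - s) * b + s * β := by nlinarith
  intro n
  induction n using Nat.strong_induction_on with
  | _ n ihn =>
  intro t u vv m hcard ht hadm
  suffices inner : ∀ (M : ℕ) (u vv m : ι → ℝ), AdmissibleOn s b β V t u vv m →
      ∑ l ∈ t, petalWt b β u vv m l = M → DomOn s b β V t u vv m from inner _ u vv m hadm rfl
  intro M
  induction M using Nat.strong_induction_on with
  | _ M ihM =>
  intro u vv m hadm hM
  obtain ⟨hub, hu1, hvβ, hv1, hmb, hmu, hmv, hpu, hpv, hpg⟩ := id hadm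
  have hu0 : ∀ l ∈ t, 0 ≤ u l := fun l hl => hb.le.trans (hub l hl)
  have hm0 : ∀ l ∈ t, 0 ≤ m l := fun l hl => hb.le.trans (hmb l hl)
  have hv0 : ∀ l ∈ t, 0 ≤ vv l := fun l hl => hβ.le.trans (hvβ l hl)
  have hc0 : ∀ l ∈ t, 0 ≤ (1 - s) * m l + s * vv l := fun l hl =>
    add_nonneg (mul_nonneg hs' (hm0 l hl)) (mul_nonneg hs0.le (hv0 l hl))
  -- R1: two slack petals
  by_cases hB : ∃ i ∈ t, ∃ j ∈ t, i ≠ j ∧ m i < u i ∧ m j < u j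
  · obtain ⟨i, hi, j, hj, hij, hsi, hsj⟩ := hB
    have hui : 0 < u i := hb.trans_le (hub i hi)
    have huj : 0 < u j := hb.trans_le (hub j hj)
    have hmj : 0 < m j := hb.trans_le (hmb j hj)
    have hmi : 0 < m i := hb.trans_le (hmb i hi)
    set tlo := m i / u i with htlo
    set thi := u j / m j with hthi
    have hlo : 0 < tlo := div_pos hmi hui
    have hlo1 : tlo ≤ 1 := (div_le_one hui).2 hsi.le
    have hhi : 1 ≤ thi := (one_le_div hmj).2 hsj.le
    have hilo : u i * tlo = m i := by rw [htlo]; field_simp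
    have hjhi : u j / thi = m j := by rw [hthi]; field_simp
    -- the two endpoint families
    have hadm_lo := admissibleOn_uExchange hb hadm hij hi hj hlo (le_of_eq hilo.symm)
      (by nlinarith [hmu j hj] : m j * tlo ≤ u j)
    have hadm_hi := admissibleOn_uExchange hb hadm hij hi hj (by linarith)
      (by nlinarith [hmu i hi] : m i ≤ u i * thi) (by rw [hthi]; field_simp; exact le_rfl : m j * thi ≤ u j)
    -- their measures drop
    have hM_lo : ∑ l ∈ t, petalWt b β (Function.update (Function.update u i (u i * tlo)) j (u j / tlo)) vv m l < M := by
      rw [← hM]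
      refine sum_lt_of_pair hij hi hj (fun l _ hli hlj => petalWt_congr (uExchange_apply_other tlo hli hlj) rfl rfl) ?_
      have h1 : petalWt b β (Function.update (Function.update u i (u i * tlo)) j (u j / tlo)) vv m i ≤ 1 :=
        petalWt_le_one_of_tight (by rw [Function.update_of_ne hij, Function.update_self, hilo])
      have h2 : petalWt b β (Function.update (Function.update u i (u i * tlo)) j (u j / tlo)) vv m j = 2 :=
        petalWt_of_slack (by rw [Function.update_self]; exact lt_of_lt_of_le hsj (le_div_self (hu0 j hj) hlo hlo1))
      rw [h2, petalWt_of_slack hsi, petalWt_of_slack hsj]; omega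
    have hM_hi : ∑ l ∈ t, petalWt b β (Function.update (Function.update u i (u i * thi)) j (u j / thi)) vv m l < M := by
      rw [← hM]
      refine sum_lt_of_pair hij hi hj (fun l _ hli hlj => petalWt_congr (uExchange_apply_other thi hli hlj) rfl rfl) ?_
      have h1 : petalWt b β (Function.update (Function.update u i (u i * thi)) j (u j / thi)) vv m j ≤ 1 :=
        petalWt_le_one_of_tight (by rw [Function.update_self, hjhi])
      have h2 : petalWt b β (Function.update (Function.update u i (u i * thi)) j (u j / thi)) vv m i = 2 :=
        petalWt_of_slack (by
          rw [Function.update_of_ne hij, Function.update_self]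
          exact lt_of_lt_of_le hsi (le_mul_of_one_le_right (hu0 i hi) hhi))
      rw [h2, petalWt_of_slack hsi, petalWt_of_slack hsj]; omega
    have hdom_lo := ihM _ hM_lo _ _ _ hadm_lo rfl
    have hdom_hi := ihM _ hM_hi _ _ _ hadm_hi rfl
    intro k
    refine (coeff_uExchange_le_max hs0.le hs1 hu0 hc0 hij hi hj hlo hlo1 hhi k).trans (max_le (hdom_lo k) (hdom_hi k))
  -- R2: two tight rich petals
  by_cases hC : ∃ i ∈ t, ∃ j ∈ t, i ≠ j ∧ (m i = u i ∧ b < m i ∧ β < vv i) ∧ (m j = u j ∧ b < m j ∧ β < vv j)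
  · obtain ⟨i, hi, j, hj, hij, ⟨hti, hbi, hvi⟩, ⟨htj, hbj, hvj⟩⟩ := hC
    have hmi : 0 < m i := hb.trans hbi
    have hmj : 0 < m j := hb.trans hbj
    have hvvi : 0 < vv i := hβ.trans hvi
    have hvvj : 0 < vv j := hβ.trans hvj
    set tlo := max (b / m i) (β / vv i) with htlo
    set thi := min (m j / b) (vv j / β) with hthi
    have hlo : 0 < tlo := lt_max_of_lt_left (div_pos hb hmi)
    have hlo1 : tlo ≤ 1 := max_le ((div_le_one hmi).2 hbi.le) ((div_le_one hvvi).2 hvi.le)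
    have hhi : 1 ≤ thi := le_min ((one_le_div hb).2 hbj.le) ((one_le_div hβ).2 hvj.le)
    have hthi0 : 0 < thi := lt_of_lt_of_le zero_lt_one hhi
    -- endpoint conditions
    have c1 : b ≤ m i * tlo := by
      calc b = m i * (b / m i) := by field_simp
        _ ≤ m i * tlo := mul_le_mul_of_nonneg_left (le_max_left _ _) hmi.le
    have c2 : β ≤ vv i * tlo := by
      calc β = vv i * (β / vv i) := by field_simp
        _ ≤ vv i * tlo := mul_le_mul_of_nonneg_left (le_max_right _ _) hvvi.le
    have c3 : b * tlo ≤ m j := by nlinarith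
    have c4 : β * tlo ≤ vv j := by nlinarith
    have d1 : b ≤ m i * thi := by nlinarith
    have d2 : β ≤ vv i * thi := by nlinarith
    have d3 : b * thi ≤ m j := by
      calc b * thi ≤ b * (m j / b) := mul_le_mul_of_nonneg_left (min_le_left _ _) hb.le
        _ = m j := by field_simp
    have d4 : β * thi ≤ vv j := by
      calc β * thi ≤ β * (vv j / β) := mul_le_mul_of_nonneg_left (min_le_right _ _) hβ.le
        _ = vv j := by field_simp
    have hadm_lo := admissibleOn_scale hb hbβ hadm hij hi hj hlo c1 c2 c3 c4
    have hadm_hi := admissibleOn_scale hb hbβ hadm hij hi hj hthi0 d1 d2 d3 d4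
    -- measures drop: the shrunk petal is no longer rich
    have hnr_lo : ¬ (b < m i * tlo ∧ β < vv i * tlo) := by
      rcases max_choice (b / m i) (β / vv i) with h | h
      · have : m i * tlo = b := by rw [htlo, h]; field_simp
        exact fun hh => absurd hh.1 (by rw [this]; exact lt_irrefl b)
      · have : vv i * tlo = β := by rw [htlo, h]; field_simp
        exact fun hh => absurd hh.2 (by rw [this]; exact lt_irrefl β)
    have hnr_hi : ¬ (b < m j / thi ∧ β < vv j / thi) := by
      rcases min_choice (m j / b) (vv j / β) with h | h
      · have : m j / thi = b := by rw [hthi, h]; field_simp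
        exact fun hh => absurd hh.1 (by rw [this]; exact lt_irrefl b)
      · have : vv j / thi = β := by rw [hthi, h]; field_simp
        exact fun hh => absurd hh.2 (by rw [this]; exact lt_irrefl β)
    have hM_lo : ∑ l ∈ t, petalWt b β (Function.update (Function.update u i (u i * tlo)) j (u j / tlo))
        (Function.update (Function.update vv i (vv i * tlo)) j (vv j / tlo))
        (Function.update (Function.update m i (m i * tlo)) j (m j / tlo)) l < M := by
      rw [← hM]
      refine sum_lt_of_pair hij hi hj (fun l _ hli hlj => petalWt_congr (uExchange_apply_other tlo hli hlj)
        (uExchange_apply_other tlo hli hlj) (uExchange_apply_other tlo hli hlj)) ?_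
      have h1 : petalWt b β (Function.update (Function.update u i (u i * tlo)) j (u j / tlo))
          (Function.update (Function.update vv i (vv i * tlo)) j (vv j / tlo))
          (Function.update (Function.update m i (m i * tlo)) j (m j / tlo)) i = 0 :=
        petalWt_of_tight_nonrich (by simp only [Function.update_of_ne hij, Function.update_self, hti])
          (by simp only [Function.update_of_ne hij, Function.update_self]; exact hnr_lo)
      have h2 : petalWt b β (Function.update (Function.update u i (u i * tlo)) j (u j / tlo))
          (Function.update (Function.update vv i (vv i * tlo)) j (vv j / tlo))
          (Function.update (Function.update m i (m i * tlo)) j (m j / tlo)) j = 1 :=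
        petalWt_of_rich (by simp only [Function.update_self, htj])
          (by simp only [Function.update_self]; exact lt_of_lt_of_le hbj (le_div_self hmj.le hlo hlo1))
          (by simp only [Function.update_self]; exact lt_of_lt_of_le hvj (le_div_self hvvj.le hlo hlo1))
      rw [h1, h2, petalWt_of_rich hti hbi hvi, petalWt_of_rich htj hbj hvj]
    have hM_hi : ∑ l ∈ t, petalWt b β (Function.update (Function.update u i (u i * thi)) j (u j / thi))
        (Function.update (Function.update vv i (vv i * thi)) j (vv j / thi))
        (Function.update (Function.update m i (m i * thi)) j (m j / thi)) l < M := by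
      rw [← hM]
      refine sum_lt_of_pair hij hi hj (fun l _ hli hlj => petalWt_congr (uExchange_apply_other thi hli hlj)
        (uExchange_apply_other thi hli hlj) (uExchange_apply_other thi hli hlj)) ?_
      have h1 : petalWt b β (Function.update (Function.update u i (u i * thi)) j (u j / thi))
          (Function.update (Function.update vv i (vv i * thi)) j (vv j / thi))
          (Function.update (Function.update m i (m i * thi)) j (m j / thi)) j = 0 :=
        petalWt_of_tight_nonrich (by simp only [Function.update_self, htj])
          (by simp only [Function.update_self]; exact hnr_hi)
      have h2 : petalWt b β (Function.update (Function.update u i (u i * thi)) j (u j / thi))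
          (Function.update (Function.update vv i (vv i * thi)) j (vv j / thi))
          (Function.update (Function.update m i (m i * thi)) j (m j / thi)) i = 1 :=
        petalWt_of_rich (by simp only [Function.update_of_ne hij, Function.update_self, hti])
          (by simp only [Function.update_of_ne hij, Function.update_self]
              exact lt_of_lt_of_le hbi (le_mul_of_one_le_right hmi.le hhi))
          (by simp only [Function.update_of_ne hij, Function.update_self]
              exact lt_of_lt_of_le hvi (le_mul_of_one_le_right hvvi.le hhi))
      rw [h1, h2, petalWt_of_rich hti hbi hvi, petalWt_of_rich htj hbj hvj]
    have hdom_lo := ihM _ hM_lo _ _ _ hadm_lo rfl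
    have hdom_hi := ihM _ hM_hi _ _ _ hadm_hi rfl
    intro k
    exact (coeff_scale_le_max hs0.le hs1 hu0 hm0 hv0 hij hi hj hlo hlo1 hhi k).trans (max_le (hdom_lo k) (hdom_hi k))
  -- R3: two h-petals
  by_cases hD : ∃ i ∈ t, ∃ j ∈ t, i ≠ j ∧ (u i = b ∧ m i = b ∧ β < vv i) ∧ (u j = b ∧ m j = b ∧ β < vv j)
  · obtain ⟨i, hi, j, hj, hij, ⟨hui, hmi, _⟩, ⟨huj, hmj, _⟩⟩ := hD
    set v' := (((1 - s) * b + s * vv i) * ((1 - s) * b + s * vv j) / ((1 - s) * b + s * β) - (1 - s) * b) / s with hv'd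
    have hv' : ((1 - s) * b + s * β) * ((1 - s) * b + s * v') = ((1 - s) * b + s * vv i) * ((1 - s) * b + s * vv j) := by
      rw [hv'd]; field_simp; ring
    have hadm' := admissibleOn_merge_h hb hbβ hs0 hs1 hadm hij hi hj hmi huj hmj hv'
    have hit' : i ∈ t.erase j := mem_erase.2 ⟨hij, hi⟩
    have hcard' : (t.erase j).card < n := by rw [card_erase_of_mem hj, ← hcard]; exact Nat.sub_lt (card_pos.2 ht) one_pos
    have hdom' := ihn _ hcard' (t.erase j) _ _ _ rfl ⟨i, hit'⟩ hadm'
    exact domOn_of_merge_h hb hbβ hs0 hs1 hadm hij hi hj hui hmi huj hmj hv' hdom'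
  -- R4: an h-petal and a leveraged tight rich petal
  by_cases hE : ∃ i ∈ t, ∃ j ∈ t, (u i = b ∧ m i = b ∧ β < vv i) ∧ (m j = u j ∧ b < m j ∧ β < vv j) ∧ β * m j ≤ b * vv j
  · obtain ⟨i, hi, r, hr, ⟨hui, hmi, _⟩, ⟨hmr, hbr, _⟩, hlev⟩ := hE
    have hri : r ≠ i := fun e => by rw [e, hmi] at hbr; exact lt_irrefl b hbr
    set v' := (((1 - s) * m r + s * vv r) * ((1 - s) * b + s * vv i) / ((1 - s) * b + s * β) - (1 - s) * m r) / s with hv'd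
    have hv' : ((1 - s) * b + s * β) * ((1 - s) * m r + s * v') = ((1 - s) * m r + s * vv r) * ((1 - s) * b + s * vv i) := by
      rw [hv'd]; field_simp; ring
    have hadm' := admissibleOn_merge_hT hb hbβ hs0 hs1 hadm hri hi hr hui hmi hlev hv'
    have hrt' : r ∈ t.erase i := mem_erase.2 ⟨hri, hr⟩
    have hcard' : (t.erase i).card < n := by rw [card_erase_of_mem hi, ← hcard]; exact Nat.sub_lt (card_pos.2 ht) one_pos
    have hdom' := ihn _ hcard' (t.erase i) _ _ _ rfl ⟨r, hrt'⟩ hadm'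
    exact domOn_of_merge_hT hb hbβ hβ1 hs0 hs1 hadm hri hi hr hui hmi hmr hv' hdom'
  -- irreducible
  refine domOn_irreducible hb hbβ hβ1 hs0.le hs1 ht hadm ?_ ?_ ?_ ?_
  · intro i hi j hj hsi hsj
    by_contra hij
    exact hB ⟨i, hi, j, hj, hij, hsi, hsj⟩
  · intro i hi j hj hri hrj
    by_contra hij
    exact hC ⟨i, hi, j, hj, hij, hri, hrj⟩
  · intro i hi j hj hhi hhj
    by_contra hij
    exact hD ⟨i, hi, j, hj, hij, hhi, hhj⟩
  · intro i hi j hj hhi hrj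
    exact lt_of_not_ge fun hle => hE ⟨i, hi, j, hj, hhi, hrj, hle⟩

/-! ## T-BERN and its consequences -/

/-- **T-BERN holds**: `TBern s b β V` for `0 < b ≤ β ≤ 1`, `0 ≤ s ≤ 1`. [this work] -/
theorem tbern_holds {s b β V : ℝ} (hb : 0 < b) (hbβ : b ≤ β) (hβ1 : β ≤ 1) (hs0 : 0 ≤ s) (hs1 : s ≤ 1) :
    TBern s b β V := by
  classical
  refine tbern_of_floorFree hb hbβ hs0 hs1 fun n t u vv m hne hadm _ => ?_
  rcases eq_or_lt_of_le hs0 with hs00 | hspos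
  · -- s = 0: every petal is non-leveraged
    refine domOn_of_noLeverage hb hbβ hs0 hs1 hne hadm fun j hj => ?_
    obtain ⟨_, _, _, _, _, hmu, _⟩ := hadm
    rw [← hs00]
    have := hmu j hj
    nlinarith
  · exact domOn_all hb hbβ hβ1 hspos hs1 t.card t u vv m rfl hne hadm

/-- **The capped pendant lemma holds**: `CappedPendant s t b β V` for `0 < b ≤ β ≤ 1`, `s, t ∈ [0,1]`. [this work] -/
theorem cappedPendant_holds {s t b β V : ℝ} (hb : 0 < b) (hbβ : b ≤ β) (hβ1 : β ≤ 1) (hs0 : 0 ≤ s) (hs1 : s ≤ 1)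
    (ht0 : 0 ≤ t) (ht1 : t ≤ 1) : CappedPendant s t b β V :=
  cappedPendant_of_tbern (tbern_holds hb hbβ hβ1 hs0 hs1) ht0 ht1

/-- **(RES0′) FOR ALL `n`, UNCONDITIONALLY.**  The conclusion of `res0_of_cappedPendant` (`…SunflowerCappedPendant`: the sharp
product inequality `∏_S G_j ≤ (g*)^(|S|−1)·a` for the abstract sunflower cubic, every admissible family, every number of petals)
with its hypothesis `CappedPendant …` discharged by `cappedPendant_holds`; coins `σ, τ, s ∈ [0,1]`, floors
`0 < α₀₀ ≤ α₀₁ ≤ α₁₁`, petals as there. [this work] -/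
theorem res0_all {κ : Type*} [DecidableEq κ] {τ σ s α00 α01 α11 : ℝ} (hτ0 : 0 ≤ τ) (hτ1 : τ ≤ 1) (hσ0 : 0 ≤ σ)
    (hσ1 : σ ≤ 1) (hs0 : 0 ≤ s) (hs1 : s ≤ 1) (hα0 : 0 < α00) (h01 : α00 ≤ α01) (h11 : α01 ≤ α11)
    (S : Finset κ) (hS : S.Nonempty) (y k gc h : κ → ℝ)
    (hy : ∀ j ∈ S, α00 ≤ y j) (hy1 : ∀ j ∈ S, y j ≤ 1) (hk : ∀ j ∈ S, α01 ≤ k j) (hk1 : ∀ j ∈ S, k j ≤ 1)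
    (hg : ∀ j ∈ S, α01 ≤ gc j) (hgk : ∀ j ∈ S, gc j ≤ k j) (hgh : ∀ j ∈ S, gc j ≤ h j) (hh : ∀ j ∈ S, α11 ≤ h j)
    (hh1 : ∀ j ∈ S, h j ≤ 1)
    (hBY : ∏ j ∈ S, ((1 - s) * y j + s * k j) ≤ ((1 - s) * α00 + s * α01) ^ (S.card - 1))
    (hBh : ∏ j ∈ S, h j ≤ α11 ^ (S.card - 1))
    (hBH : ∏ j ∈ S, ((1 - σ) * gc j + σ * h j) ≤ ((1 - σ) * α01 + σ * α11) ^ (S.card - 1)) :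
    ∏ j ∈ S, (τ * σ + (1 - τ) * (1 - s) * α00 + τ * (1 - σ) * ((1 - s) * y j + s * k j) +
        s * (1 - τ) * ((1 - σ) * gc j + σ * h j)) ≤
      (τ * σ + (1 - τ) * (1 - s) * α00 + τ * (1 - σ) * ((1 - s) * α00 + s * α01) +
        s * (1 - τ) * ((1 - σ) * α01 + σ * α11)) ^ (S.card - 1) *
        (τ * σ + (1 - τ) * (1 - s) * α00 + τ * (1 - σ) + s * (1 - τ)) := by
  obtain ⟨j₀, hj₀⟩ := hS
  have hα11 : α11 ≤ 1 := (hh j₀ hj₀).trans (hh1 j₀ hj₀)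
  have hs' : 0 ≤ 1 - s := sub_nonneg.2 hs1
  have hb : 0 < (1 - s) * α00 + s * α01 := by nlinarith
  have hbβ : (1 - s) * α00 + s * α01 ≤ s * α11 + (1 - s) * α00 := by nlinarith [mul_le_mul_of_nonneg_left h11 hs0]
  have hβ1 : s * α11 + (1 - s) * α00 ≤ 1 := by nlinarith [h01.trans (h11.trans hα11)]
  exact res0_of_cappedPendant hσ0 hσ1 hs0 hs1 hα0 h01 h11 (cappedPendant_holds hb hbβ hβ1 hσ0 hσ1 hτ0 hτ1) S ⟨j₀, hj₀⟩
    y k gc h hy hy1 hk hk1 hg hgk hgh hh hh1 hBY hBh hBH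

end LinkedCurrency

end SafeCalc

end Summit.CriticalPhenomena.PercolationContinuityZ3.Theorems.SunflowerPartition
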